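import Summits.CriticalPhenomena.SAWScalingLimit.Theses.SAWExpectedSignature

/-!
# `CruxesGiveTarget` (stmt-CriticalPhenomena-14148): the route-choice glue of `SAWExpectedSignature`

The support item stmt-CriticalPhenomena-14148 of route `SAWExpectedSignature` is pure logic: the rank-0 target
`Target := MomentsIdentifySLE ∧ PVarMoments ∧ SigMomentsConverge ∧ SubseqLimitsSimple` is by definition the conjunction
of the four ranked cruxes, so the glue `MomentsIdentifySLE → PVarMoments → SigMomentsConverge → SubseqLimitsSimple → Target`
is the anonymous constructor.  (Filed by the planner as the route-choice repair "target-unreachable", option (a); the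
refuter's candidate proof of 2026-08-16 is the same term.)  No mathematics; landed so that the item closes.
-/

namespace Summit.CriticalPhenomena.SAWScalingLimit.Theorems

open Summit.CriticalPhenomena.SAWScalingLimit.Theses

/-- **`CruxesGiveTarget` (stmt-CriticalPhenomena-14148)**: the four cruxes of route `SAWExpectedSignature` give its target,
which is their conjunction by definition. [folklore] -/
theorem ExpectedSignatureCruxesGiveTarget_proof : SAWExpectedSignature.CruxesGiveTarget :=
  fun hM hV hC hS => ⟨hM, hV, hC, hS⟩

end Summit.CriticalPhenomena.SAWScalingLimit.Theorems
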